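import Literature.NumberTheory.DiophantineGeometry.AbcWave0QualityFormProofs
import HarnessLib

/-!
# The weak abc conjecture with exponent `κ₁` (Lagarias–Soundararajan's parametrisation)

Topic `NumberTheory/DiophantineGeometry` (the `AbcWave0` neighbourhood); companion of
`XYZConjecture.lean` (the xyz conjecture record) and input of `XYZConjectureABC.lean`
(Lagarias–Soundararajan's Theorems 1.1, 2.1, 2.2, 1.3).

J. C. Lagarias, K. Soundararajan, *Smooth solutions to the abc equation: the xyz conjecture*,
J. Théor. Nombres Bordeaux 23 (2011) 209–234 [LagariasSoundararajan2011] (= arXiv:0911.4147), §1: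
"**abc conjecture (weak form).** There is a positive constant `κ₁` such that for any `ε > 0` there
are only finitely many primitive solutions `(A, B, C)` to `A + B = C` such that
`R(A, B, C) ≤ H(A, B, C)^{κ₁ - ε}`" (`R` = radical, `H` = height); "It is known that this exponent
satisfies `κ₁ ≤ 1`, and the abc conjecture is often stated in the following strong form …
**abc conjecture (strong form).** The abc conjecture holds with `κ₁ = 1`."

This file defines the parametrised predicate `ABCExponentBound κ₁` (primitive solutions = the
tree's abc triples `IsABCTriple`, `H = c`), the hypothesis of the paper's Theorem 1.1, and PROVES:

* `abcExponentBound_one_iff_abcQualityForm` — at `κ₁ = 1` it is the tree's `ABCQualityForm`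
  (abc.S05), which `AbcWave0QualityFormProofs` shows is the abc conjecture itself; so nothing here
  restates the summit under a new name: the `κ₁ = 1` instance is tied to the existing record;
* `not_abcExponentBound_of_one_lt` — "it is known that `κ₁ ≤ 1`": for `κ₁ > 1` the statement
  fails on the abc triples `(1, 2ⁿ - 1, 2ⁿ)` (`rad ≤ 2^{n+1}`).

No instance of `ABCExponentBound` is asserted (it is an open conjecture for every `0 < κ₁ ≤ 1` and
false for `κ₁ > 1`); it is a `ℝ`-indexed predicate, not a named fact.

## References

* [LagariasSoundararajan2011] Lagarias–Soundararajan, JTNB 23 (2011), doi:10.5802/jtnb.757,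
  arXiv:0911.4147 — §1 (abc conjecture, weak and strong forms; "`κ₁ ≤ 1`").
* [BombieriGubler2006] Bombieri–Gubler, *Heights in Diophantine Geometry*, Conj. 12.2.2 and
  Rem. 12.4.15 (the quality form, `ABCQualityForm`).
-/

noncomputable section

open Real UniqueFactorizationMonoid

namespace Literature.NumberTheory.DiophantineGeometry

/-! ### The predicate -/

/-- The **weak abc conjecture with exponent `κ₁`** [LagariasSoundararajan2011, §1]: for every
`ε > 0` only finitely many primitive solutions of `A + B = C` (abc triples) have radical
`R = rad(abc) ≤ H^{κ₁ - ε}`, `H = c`. The paper's "abc conjecture (weak form)" is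
`∃ κ₁ > 0, ABCExponentBound κ₁` and its "strong form" is `ABCExponentBound 1`, which is the tree's
`ABCQualityForm` (`abcExponentBound_one_iff_abcQualityForm`) and hence the abc conjecture
(`AbcWave0QualityFormProofs`); "it is known that `κ₁ ≤ 1`" is `not_abcExponentBound_of_one_lt`.
A predicate on `ℝ` used as the hypothesis of Thm. 1.1; no instance of it is asserted.
[cite: LagariasSoundararajan2011, §1 (abc conjecture, weak form)] -/
def ABCExponentBound (κ₁ : ℝ) : Prop :=
  ∀ ε : ℝ, 0 < ε →
    {t : ℕ × ℕ × ℕ | IsABCTriple t.1 t.2.1 t.2.2 ∧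
      ((rad t.1 t.2.1 t.2.2 : ℕ) : ℝ) ≤ (t.2.2 : ℝ) ^ (κ₁ - ε)}.Finite

/-- `ABCExponentBound` is downward monotone in `κ₁`. [folklore] -/
theorem ABCExponentBound.mono {κ₁ κ₁' : ℝ} (h : ABCExponentBound κ₁') (hle : κ₁ ≤ κ₁') :
    ABCExponentBound κ₁ := by
  intro ε hε
  refine (h ε hε).subset ?_
  rintro ⟨a, b, c⟩ ⟨ht, hR⟩
  dsimp only at ht hR ⊢
  refine ⟨ht, hR.trans ?_⟩
  have hc1 : 1 ≤ c := le_trans one_le_two ht.two_le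
  exact Real.rpow_le_rpow_of_exponent_le (by exact_mod_cast hc1) (by linarith)

/-- **At `κ₁ = 1` the paper's strong abc conjecture is the tree's quality form**:
`ABCExponentBound 1 ↔ ABCQualityForm` (`R ≤ c^{1-ε}` versus quality `log c / log R > 1 + ε`; an
`ε ↔ ε/(1+ε)`, `ε ↔ ε/(2(1-ε))` reparametrisation using `R ≥ 2`, `c ≥ 2` on abc triples).
[cite: LagariasSoundararajan2011, §1 (abc conjecture, strong form)] -/
theorem abcExponentBound_one_iff_abcQualityForm : ABCExponentBound 1 ↔ ABCQualityForm := by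
  constructor
  · intro h ε hε
    refine (h (ε / (1 + ε)) (by positivity)).subset ?_
    rintro ⟨a, b, c⟩ ⟨ht, hq⟩
    dsimp only at ht hq ⊢
    refine ⟨ht, ?_⟩
    rw [ht.one_add_lt_quality_iff] at hq
    have hr0 : (0 : ℝ) < (rad a b c : ℝ) := by
      exact_mod_cast (show 0 < rad a b c from lt_of_lt_of_le (by norm_num) ht.two_le_rad)
    have hexp : 1 - ε / (1 + ε) = (1 + ε)⁻¹ := by field_simp; ring
    have h1 : (rad a b c : ℝ) = ((rad a b c : ℝ) ^ (1 + ε)) ^ (1 + ε)⁻¹ :=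
      (Real.rpow_rpow_inv hr0.le (by positivity)).symm
    rw [hexp, h1]
    exact Real.rpow_le_rpow (by positivity) hq.le (by positivity)
  · intro h ε hε
    by_cases hε1 : 1 ≤ ε
    · refine Set.Finite.subset (Set.finite_empty) ?_
      rintro ⟨a, b, c⟩ ⟨ht, hR⟩
      dsimp only at ht hR
      have hc1 : (1 : ℝ) ≤ c := by exact_mod_cast le_trans one_le_two ht.two_le
      have h2 : (2 : ℝ) ≤ (rad a b c : ℝ) := by exact_mod_cast ht.two_le_rad
      have : (c : ℝ) ^ (1 - ε) ≤ 1 := Real.rpow_le_one_of_one_le_of_nonpos hc1 (by linarith)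
      exact absurd (h2.trans (hR.trans this)) (by norm_num)
    · push Not at hε1
      have hε' : 0 < ε / (2 * (1 - ε)) := by
        have : 0 < 1 - ε := by linarith
        positivity
      refine (h _ hε').subset ?_
      rintro ⟨a, b, c⟩ ⟨ht, hR⟩
      dsimp only at ht hR ⊢
      refine ⟨ht, ?_⟩
      rw [ht.one_add_lt_quality_iff]
      have hr0 : (0 : ℝ) < (rad a b c : ℝ) := by
        exact_mod_cast (show 0 < rad a b c from lt_of_lt_of_le (by norm_num) ht.two_le_rad)
      have hc1 : (1 : ℝ) < c := by exact_mod_cast lt_of_lt_of_le one_lt_two ht.two_le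
      have hc0 : (0 : ℝ) < c := zero_lt_one.trans hc1
      have hexp : (1 - ε) * (1 + ε / (2 * (1 - ε))) = 1 - ε / 2 := by
        have h1e : (1 : ℝ) - ε ≠ 0 := by linarith
        field_simp
        ring
      calc (rad a b c : ℝ) ^ (1 + ε / (2 * (1 - ε)))
          ≤ ((c : ℝ) ^ (1 - ε)) ^ (1 + ε / (2 * (1 - ε))) :=
            Real.rpow_le_rpow hr0.le hR (by positivity)
        _ = (c : ℝ) ^ (1 - ε / 2) := by rw [← Real.rpow_mul hc0.le, hexp]
        _ < (c : ℝ) ^ (1 : ℝ) := Real.rpow_lt_rpow_of_exponent_lt hc1 (by linarith)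
        _ = c := Real.rpow_one _

/-! ### "It is known that `κ₁ ≤ 1`": the family `1 + (2ⁿ - 1) = 2ⁿ` -/

/-- `(1, 2ⁿ - 1, 2ⁿ)` is an abc triple for `n ≥ 1`. [folklore] -/
theorem isABCTriple_one_two_pow_sub_one {n : ℕ} (hn : n ≠ 0) : IsABCTriple 1 (2 ^ n - 1) (2 ^ n) := by
  have h2 : 2 ≤ 2 ^ n := by
    calc 2 = 2 ^ 1 := (pow_one 2).symm
      _ ≤ 2 ^ n := Nat.pow_le_pow_right (by norm_num) (Nat.one_le_iff_ne_zero.mpr hn)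
  exact ⟨one_pos, by omega, by omega, Nat.coprime_one_left _⟩

/-- `rad(1 · (2ⁿ - 1) · 2ⁿ) ≤ 2 (2ⁿ - 1)` (`rad(xy) ∣ rad x · rad y`, `rad(2ⁿ) = 2`). [folklore] -/
theorem rad_one_two_pow_sub_one_le {n : ℕ} (hn : n ≠ 0) :
    rad 1 (2 ^ n - 1) (2 ^ n) ≤ 2 * (2 ^ n - 1) := by
  have h2 : 2 ≤ 2 ^ n := by
    calc 2 = 2 ^ 1 := (pow_one 2).symm
      _ ≤ 2 ^ n := Nat.pow_le_pow_right (by norm_num) (Nat.one_le_iff_ne_zero.mpr hn)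
  rw [rad_def, one_mul]
  have hpos : 0 < radical (2 ^ n - 1) * radical (2 ^ n) :=
    Nat.mul_pos (Nat.radical_pos _) (Nat.radical_pos _)
  calc radical ((2 ^ n - 1) * 2 ^ n) ≤ radical (2 ^ n - 1) * radical (2 ^ n) :=
        Nat.le_of_dvd hpos radical_mul_dvd
    _ = radical (2 ^ n - 1) * radical 2 := by rw [radical_pow 2 hn]
    _ ≤ (2 ^ n - 1) * 2 :=
        Nat.mul_le_mul (Nat.radical_le_self_iff.mpr (by omega)) (Nat.radical_le_self_iff.mpr (by norm_num))
    _ = 2 * (2 ^ n - 1) := mul_comm _ _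

/-- **"It is known that `κ₁ ≤ 1`"** [LagariasSoundararajan2011, §1]: the weak abc conjecture with an
exponent `κ₁ > 1` is false, since the abc triples `(1, 2ⁿ - 1, 2ⁿ)` have
`rad ≤ 2^{n+1} ≤ (2ⁿ)^{(κ₁+1)/2}` for all large `n`. [cite: LagariasSoundararajan2011, §1] -/
theorem not_abcExponentBound_of_one_lt {κ₁ : ℝ} (hκ : 1 < κ₁) : ¬ ABCExponentBound κ₁ := by
  intro h
  set e : ℝ := (κ₁ + 1) / 2 with he_def
  have he : 1 < e := by rw [he_def]; linarith
  have hfin := h ((κ₁ - 1) / 2) (by linarith)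
  have hexp : κ₁ - (κ₁ - 1) / 2 = e := by rw [he_def]; ring
  simp only [hexp] at hfin
  obtain ⟨n₀, hn₀⟩ : ∃ n₀ : ℕ, 1 / (e - 1) ≤ n₀ := exists_nat_ge _
  have hinj : Function.Injective (fun n : ℕ => ((1 : ℕ), 2 ^ (n + n₀ + 1) - 1, 2 ^ (n + n₀ + 1))) := by
    intro m n hmn
    have h2 : 2 ^ (m + n₀ + 1) = 2 ^ (n + n₀ + 1) := congrArg (fun t : ℕ × ℕ × ℕ => t.2.2) hmn
    have h3 := Nat.pow_right_injective (le_refl 2) h2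
    omega
  refine hfin.not_infinite ((Set.infinite_range_of_injective hinj).mono ?_)
  rintro _ ⟨n, rfl⟩
  have hN : n + n₀ + 1 ≠ 0 := by omega
  refine ⟨isABCTriple_one_two_pow_sub_one hN, ?_⟩
  dsimp only
  have hle := rad_one_two_pow_sub_one_le hN
  have h2N : 2 * (2 ^ (n + n₀ + 1) - 1) ≤ 2 ^ (n + n₀ + 1 + 1) := by
    have := pow_succ 2 (n + n₀ + 1); omega
  have hNe : ((n + n₀ + 1 : ℕ) : ℝ) + 1 ≤ (n + n₀ + 1 : ℕ) * e := by
    have hN0 : (n₀ : ℝ) ≤ (n + n₀ + 1 : ℕ) := by push_cast; linarith [(n.cast_nonneg : (0 : ℝ) ≤ n)]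
    have h1 : (1 : ℝ) ≤ (n + n₀ + 1 : ℕ) * (e - 1) := by
      calc (1 : ℝ) = 1 / (e - 1) * (e - 1) := by rw [one_div, inv_mul_cancel₀ (sub_pos.mpr he).ne']
        _ ≤ n₀ * (e - 1) := mul_le_mul_of_nonneg_right hn₀ (by linarith)
        _ ≤ (n + n₀ + 1 : ℕ) * (e - 1) := mul_le_mul_of_nonneg_right hN0 (by linarith)
    linarith
  calc ((rad 1 (2 ^ (n + n₀ + 1) - 1) (2 ^ (n + n₀ + 1)) : ℕ) : ℝ)
      ≤ ((2 ^ (n + n₀ + 1 + 1) : ℕ) : ℝ) := by exact_mod_cast hle.trans h2N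
    _ = (2 : ℝ) ^ (((n + n₀ + 1 : ℕ) : ℝ) + 1) := by
        rw [← Nat.cast_succ, Real.rpow_natCast]; norm_cast
    _ ≤ (2 : ℝ) ^ ((n + n₀ + 1 : ℕ) * e) := Real.rpow_le_rpow_of_exponent_le (by norm_num) hNe
    _ = ((2 ^ (n + n₀ + 1) : ℕ) : ℝ) ^ e := by
        rw [Real.rpow_mul (by norm_num), Real.rpow_natCast]; norm_cast


end Literature.NumberTheory.DiophantineGeometry

end
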